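import Mathlib
import Summits.Langlands.Langlands.Theorems.SoloInformedCotangentBound

/-!
# One-dimensional tangent space at a ramified depth-one congruence (solo-informed notes, Part II §7.11 (16.3)(d))

For a single Eisenstein congruence with `[f(𝔭), e(𝔭)] = [1,2]` the local Hecke algebra has `rank_{ℤ_p} 𝕋_𝔪 = 3`; reduced mod `p`
it is a local `𝔽_p`-algebra `A` of dimension 3 with maximal ideal `𝔪̄` of dimension 2, and depth one at some test operator gives
`𝔪̄² ≠ 0`.  The abstract statement proved here: a finite-dimensional local `k`-algebra with `dim_k 𝔪 = 2` and `𝔪² ≠ 0` has a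
ONE-dimensional cotangent space `𝔪/𝔪²` (Nakayama excludes `𝔪² = 𝔪`).  Hence such a `𝕋_𝔪` again cannot be isomorphic to a
deformation ring with two-dimensional tangent space.
-/

namespace Summit.Langlands.Langlands.Theorems

open Module IsLocalRing

/-- In a local ring whose maximal ideal is finite over a subfield `k`, `𝔪² ≠ 𝔪` unless `𝔪 = 0` (Nakayama). -/
theorem soloInformed_sq_ne_maximalIdeal (k A : Type*) [Field k] [CommRing A] [IsLocalRing A] [Algebra k A]
    [FiniteDimensional k A] (hm : 0 < finrank k (maximalIdeal A)) :
    (maximalIdeal A) ^ 2 ≠ maximalIdeal A := by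
  haveI hfin : Module.Finite k (maximalIdeal A) :=
    Module.Finite.of_injective ((Submodule.subtype (maximalIdeal A)).restrictScalars k) Subtype.val_injective
  intro h
  have hfg : (maximalIdeal A).FG := by
    haveI : Module.Finite A (maximalIdeal A) := Module.Finite.of_restrictScalars_finite k A (maximalIdeal A)
    exact Module.Finite.iff_fg.1 inferInstance
  have hbot : (maximalIdeal A : Submodule A A) = ⊥ :=
    Submodule.eq_bot_of_le_smul_of_le_jacobson_bot (maximalIdeal A) (maximalIdeal A) hfg
      (le_of_eq (by rw [Ideal.smul_eq_mul, ← pow_two, h])) (maximalIdeal_le_jacobson ⊥)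
  exact (Submodule.nontrivial_iff_ne_bot.1 (Module.nontrivial_of_finrank_pos hm)) hbot

/-- §7.11 (16.3)(d): `dim_k 𝔪 = 2` and `𝔪² ≠ 0` force `dim_k (𝔪/𝔪²) = 1`. -/
theorem soloInformed_finrank_cotangent_eq_one (k A : Type*) [Field k] [CommRing A] [IsLocalRing A] [Algebra k A]
    [FiniteDimensional k A] (hm : finrank k (maximalIdeal A) = 2) (hsq : (maximalIdeal A) ^ 2 ≠ ⊥) :
    finrank k (maximalIdeal A).Cotangent = 1 := by
  have hadd := soloInformed_finrank_cotangent_add_finrank_sq k A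
  haveI hfin : Module.Finite k (maximalIdeal A) :=
    Module.Finite.of_injective ((Submodule.subtype (maximalIdeal A)).restrictScalars k) Subtype.val_injective
  haveI hfin2 : Module.Finite k ↥((maximalIdeal A) ^ 2) :=
    Module.Finite.of_injective ((Submodule.subtype ((maximalIdeal A) ^ 2)).restrictScalars k) Subtype.val_injective
  -- (1) `𝔪² ≠ 0` gives a positive dimension
  have h1 : 0 < finrank k ↥((maximalIdeal A) ^ 2) := by
    haveI : Nontrivial ↥((maximalIdeal A) ^ 2) := Submodule.nontrivial_iff_ne_bot.2 hsq
    exact Module.finrank_pos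
  -- (2) `𝔪² ≠ 𝔪` (Nakayama) gives dimension `< 2`
  have hne : (maximalIdeal A) ^ 2 ≠ maximalIdeal A := soloInformed_sq_ne_maximalIdeal k A (by omega)
  have h2 : finrank k ↥((maximalIdeal A) ^ 2) < 2 := by
    by_contra hge
    have hge' : 2 ≤ finrank k ↥((maximalIdeal A) ^ 2) := not_lt.1 hge
    have hle : ((maximalIdeal A) ^ 2).restrictScalars k ≤ (maximalIdeal A).restrictScalars k := by
      intro x hx
      exact Ideal.pow_le_self two_ne_zero hx
    have hmono : finrank k ↥(((maximalIdeal A) ^ 2).restrictScalars k) ≤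
        finrank k ↥((maximalIdeal A).restrictScalars k) := Submodule.finrank_mono hle
    have e1 : finrank k ↥(((maximalIdeal A) ^ 2).restrictScalars k) = finrank k ↥((maximalIdeal A) ^ 2) := rfl
    have e2 : finrank k ↥((maximalIdeal A).restrictScalars k) = finrank k ↥(maximalIdeal A) := rfl
    have heq := Submodule.eq_of_le_of_finrank_eq hle (by omega)
    exact hne ((Submodule.restrictScalars_injective k A A) heq)
  omega

end Summit.Langlands.Langlands.Theorems
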